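import Literature.NumberTheory.GaloisRepresentations.SolvableDihedralCharTwo
import HarnessLib

/-!
# The solvable case of Dickson's classification in arbitrary characteristic:
# irreducible solvable subgroups of `GL₂(k)` are of dihedral, tetrahedral or octahedral type

Topic `Literature/NumberTheory/GaloisRepresentations`; theorems only (no definitions, no named
facts).  Companion of `ProjectiveTypeSolvable` (the same statement for `char k = 0`,
`isDihedralType_or_isTetrahedralType_or_isOctahedralType`, hypothesis `[CharZero k]`), of
`SerreProp16PGL2` (Serre 1972, Prop. 16: finite subgroups of `PGL₂(k)` of order *prime to*
`char k`) and of `SolvableDihedralCharTwo` (Khare–Wintenberger (I), Lemma 6.1: `char k = 2`),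
and an input of the proof of Serre's modularity conjecture
(`Literature.NumberTheory.Automorphic.khare_wintenberger`), Khare–Wintenberger (I), proof of
Lemma 6.3 (i): "We see that if the image of `ρ̄` is solvable, as `t > 5`, then by Dickson's
theorem the projective image of `ρ̄` is dihedral."  Here `ρ̄ : G_ℚ → GL₂(𝔽̄_p)` for an
*arbitrary* prime `p`, and the order of the image may be divisible by `p` (e.g. `SL₂(𝔽₃)` in
characteristic `3`, projectively `𝔄₄ ≅ PSL₂(𝔽₃)`), so neither the characteristic-`0` file nor
Serre's Prop. 16 applies; what is used is the solvable case of Dickson's classification of the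
finite subgroups of `PGL₂(k̄)` (Dickson 1901, §260; Huppert, *Endliche Gruppen I*, II.8.27):

> Let `k` be an algebraically closed field (of any characteristic) and `G ≤ GL₂(k)` a finite
> solvable subgroup acting irreducibly on `k²`.  Then the image of `G` in `PGL₂(k)` is dihedral
> `D_m` (`m ≥ 2`), or isomorphic to `𝔄₄`, or to `𝔖₄`.  In particular, if it contains an
> element of order `> 4`, it is dihedral.

## Main results (all proved)

* `projectiveType_of_not_hasCommonEigenvector_anyChar` — `G` finite, `k` algebraically closed of
  any characteristic, `ρ : G →* GL₂(k)` without common eigenvector and with solvable projective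
  image ⇒ `IsDihedralType ρ ∨ IsTetrahedralType ρ ∨ IsOctahedralType ρ`.
* `isDihedralType_or_isTetrahedralType_or_isOctahedralType_anyChar` — the same for
  `ρ : G →* GL₂(k)` with finite solvable image and irreducible standard representation: the
  statement of `isDihedralType_or_isTetrahedralType_or_isOctahedralType` with `[CharZero k]`
  removed.
* `isDihedralType_of_lt_orderOf_anyChar` — if moreover some `\bar ρ(g)` has order `> 4` in
  `PGL₂(k)`, then `ρ` is of dihedral type (the elements of `𝔖₄` have order `≤ 4`:
  `orderOf_perm_fin_four_le`); `isDihedralType_subtype_of_lt_orderOf` — the same for a finite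
  solvable `H ≤ GL₂(k)` acting irreducibly, as invoked by Khare–Wintenberger.

## The proof

The architecture is that of `ProjectiveTypeSolvable.projectiveType_of_not_hasCommonEigenvector`
(last non-trivial term `M` of the derived series of `\bar ρ(G)`, abelian and normal; `M` cyclic
⇒ dihedral; `M` non-cyclic ⇒ a self-centralising normal Klein four-subgroup ⇒ `D_2, D_4, 𝔄₄`
or `𝔖₄`), whose two characteristic-dependent steps are redone:

* **`M` has no element of order `p = char k`** (`hasCommonEigenvector_of_unipotents`).  An
  element of `PGL₂(k)` of order `p` is the class of a unipotent `1 + n`, `n ≠ 0`, `n² = 0`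
  (`PGL2AnyChar.exists_eq_smul_one_add_of_mk_pow_char`: `x^p` is a scalar `e = f^p`, and
  `(f⁻¹x - 1)^p = f^{-p}x^p - 1 = 0`, a nilpotent `2 × 2` matrix squares to `0`).  Two such
  classes which commute *projectively* commute genuinely
  (`PGL2AnyChar.commute_of_smul_mul_eq`, characteristic-free: from
  `(1+n)(1+n') = c (1+n')(1+n)` one gets `n n' n = c · n n' n` and, if `c ≠ 1`, `n' n = -n`,
  whence `n = 0`), and then share their eigenline (`CharTwoPGL2.mulVec_eq_zero_of_commute`).  So
  if `M` had an element of order `p`, the elements of order `p` of `M` would be a non-empty,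
  conjugation-stable, pairwise commuting family of unipotent classes, and the eigenline of one
  of them would be a common eigenvector of `ρ(G)` — excluded.  Hence every element of `M` has
  order prime to `char k`, and its non-scalar lifts diagonalise with distinct eigenvalues
  (`CharTwoPGL2.exists_conj_eq_diagonal_of_mk_pow_eq_one`, from the tree's characteristic-free
  `Serre1972.exists_conj_eq_diagonal_of_natCast_ne_zero`).  This replaces the
  characteristic-`0` diagonalisation `GL2.exists_conj_eq_diagonal`.
* **`2 ≠ 0` in the Klein case.**  If `M` is not cyclic it contains the class of an antidiagonal
  matrix, an involution; by the previous step `2 ≠ char k`, which is all that Lemma K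
  (`GL2.mk_mem_klein`, hypothesis `[NeZero (2 : k)]`) and the Klein four-group analysis
  (`projectiveType_of_klein_of_neZero_two`) need; in the `2`-group sub-case the central element
  has `2`-power order, again prime to `char k`.

In characteristic `2` the Klein case is therefore vacuous and the conclusion is "dihedral", in
accordance with `SolvableDihedralCharTwo` (which is not used here).

## References

* [KhareWintenberger2009] C. Khare, J.-P. Wintenberger, *Serre's modularity conjecture (I)*,
  Invent. Math. 178 (2009), 485–504, §6, proof of Lemma 6.3 (i) (the invocation of Dickson's
  theorem for solvable images with an element of large order).
* [Huppert1967] B. Huppert, *Endliche Gruppen I*, Grundlehren 134, Springer (1967), Kap. II,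
  §8, Hauptsatz 8.27 (Dickson's classification of the subgroups of `PSL(2, p^f)`).
* L. E. Dickson, *Linear groups with an exposition of the Galois field theory*, Teubner (1901),
  §260 (not keyed).
* [Serre1972] J.-P. Serre, *Propriétés galoisiennes des points d'ordre fini des courbes
  elliptiques*, Invent. Math. 15 (1972), §2.5, Prop. 16 (the prime-to-`p` case, tree file
  `SerreProp16PGL2`).
-/

open Matrix Subgroup
open scoped MatrixGroups

namespace Literature.NumberTheory.GaloisRepresentations

/-! ### Part 1: unipotent classes in `PGL₂(k)` -/

namespace PGL2AnyChar

variable {k : Type*} [Field k]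

/-- A nilpotent `2 × 2` matrix over a field squares to zero (its characteristic polynomial is
`X²`; Cayley–Hamilton). [folklore] -/
theorem mul_self_eq_zero_of_pow_eq_zero {n : Matrix (Fin 2) (Fin 2) k} {m : ℕ} (h : n ^ m = 0) :
    n * n = 0 := by
  have h1 : IsNilpotent (n.charpoly - Polynomial.X ^ 2) := by
    simpa using Matrix.isNilpotent_charpoly_sub_pow_of_isNilpotent (M := n) ⟨m, h⟩
  have h2 : n.charpoly = Polynomial.X ^ 2 := sub_eq_zero.mp h1.eq_zero
  have h3 := Matrix.aeval_self_charpoly n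
  rw [h2, map_pow, Polynomial.aeval_X, pow_two] at h3
  exact h3

open Matrix.ProjGenLinGroup in
/-- If `\bar y ^ t = 1` in `PGL₂(k)` (`t ≠ 0`, `k` algebraically closed) then `y = f · a` with
`f` a non-zero scalar and `a ^ t = 1` (`y^t` is a scalar `e`, take `f^t = e`). [folklore] -/
theorem exists_eq_scalar_mul_of_mk_pow_eq_one [IsAlgClosed k] (y : GL (Fin 2) k) {t : ℕ}
    (ht : t ≠ 0) (hyt : mk y ^ t = 1) :
    ∃ (f : kˣ) (a : GL (Fin 2) k), a ^ t = 1 ∧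
      y = Matrix.GeneralLinearGroup.scalar (Fin 2) f * a := by
  rw [← map_pow, Matrix.ProjGenLinGroup.mk_eq_one,
    Matrix.GeneralLinearGroup.center_eq_range_scalar] at hyt
  obtain ⟨e, he⟩ := hyt
  obtain ⟨f, hf⟩ := IsAlgClosed.exists_pow_nat_eq (e : k) (Nat.pos_of_ne_zero ht)
  have hf0 : f ≠ 0 := by
    rintro rfl
    rw [zero_pow ht] at hf
    exact e.ne_zero hf.symm
  set s : GL (Fin 2) k := Matrix.GeneralLinearGroup.scalar (Fin 2) (Units.mk0 f hf0) with hs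
  have hsc : s ∈ center (GL (Fin 2) k) := by
    rw [Matrix.GeneralLinearGroup.center_eq_range_scalar]
    exact ⟨_, rfl⟩
  have hst : s ^ t = y ^ t := by
    rw [hs, ← map_pow, ← he]
    congr 1
    ext
    rw [Units.val_pow_eq_pow_val, Units.val_mk0, hf]
  refine ⟨Units.mk0 f hf0, s⁻¹ * y, ?_, ?_⟩
  · have hcomm : Commute s⁻¹ y := (Subgroup.mem_center_iff.mp (inv_mem hsc) y).symm
    rw [hcomm.mul_pow, inv_pow, hst, inv_mul_cancel]
  · rw [← hs, mul_inv_cancel_left]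

open Matrix.ProjGenLinGroup in
/-- **Elements of order `p = char k` of `PGL₂(k)` are unipotent classes** (`k` algebraically
closed of characteristic `p`): if `\bar x ^ p = 1` then `x = c (1 + n)` with `c ≠ 0` and
`n² = 0`.  (Write `x = f a` with `a^p = 1`; then `(a - 1)^p = a^p - 1 = 0`, and a nilpotent
`2 × 2` matrix squares to zero.) [folklore] -/
theorem exists_eq_smul_one_add_of_mk_pow_char [IsAlgClosed k] {p : ℕ} [Fact p.Prime] [CharP k p]
    {x : GL (Fin 2) k} (hx : mk x ^ p = 1) :
    ∃ (c : k) (n : Matrix (Fin 2) (Fin 2) k), c ≠ 0 ∧ n * n = 0 ∧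
      (x : Matrix (Fin 2) (Fin 2) k) = c • (1 + n) := by
  have hp : p.Prime := Fact.out
  obtain ⟨f, a, hat, hxa⟩ := exists_eq_scalar_mul_of_mk_pow_eq_one x hp.ne_zero hx
  set n : Matrix (Fin 2) (Fin 2) k := (a : Matrix (Fin 2) (Fin 2) k) - 1 with hn
  have hnp : n ^ p = 0 := by
    rw [hn, sub_pow_char_of_commute (p := p) (Commute.one_right _), one_pow,
      ← Units.val_pow_eq_pow_val, hat, Units.val_one, sub_self]
  refine ⟨(f : k), n, f.ne_zero, mul_self_eq_zero_of_pow_eq_zero hnp, ?_⟩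
  rw [hxa, Matrix.GeneralLinearGroup.coe_mul, Matrix.GeneralLinearGroup.coe_scalar, hn,
    add_sub_cancel]
  ext i j
  fin_cases i <;> fin_cases j <;> simp [Matrix.scalar_apply]

/-- **Projectively commuting unipotents commute** (any characteristic).  If `n² = 0`, `n'² = 0`,
`n ≠ 0` and `(1 + n)(1 + n') = c · (1 + n')(1 + n)` for a scalar `c`, then `n n' = n' n`.
Right-multiplying by `n` gives `n + n'n + n n' n = c (n + n' n)`, left-multiplying this by `n`
gives `n n' n = c · n n' n`; so either `c = 1` (and the relation is genuine commutation) or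
`n n' n = 0`, `n + n' n = 0`, and then `0 = n'² n = -n' n`, `n = 0`. [folklore] -/
theorem commute_of_smul_eq {n n' : Matrix (Fin 2) (Fin 2) k} (hn : n * n = 0)
    (hn' : n' * n' = 0) (hn0 : n ≠ 0) {c : k}
    (h : (1 + n) * (1 + n') = c • ((1 + n') * (1 + n))) : n * n' = n' * n := by
  -- (**) : `n + n' n + n n' n = c • (n + n' n)`
  have e1 : (1 + n) * (1 + n') * n = n + n' * n + n * n' * n := by
    have : (1 + n) * (1 + n') * n = n + n * n + n' * n + n * n' * n := by noncomm_ring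
    rw [this, hn, add_zero]
  have e2 : (1 + n') * (1 + n) * n = n + n' * n := by
    have : (1 + n') * (1 + n) * n = n + n * n + n' * n + n' * (n * n) := by noncomm_ring
    rw [this, hn, add_zero, mul_zero, add_zero]
  have E2 : n + n' * n + n * n' * n = c • (n + n' * n) := by
    have := congrArg (· * n) h
    simpa only [smul_mul_assoc, e1, e2] using this
  -- (***) : `n n' n = c • (n n' n)`
  have E3 : n * n' * n = c • (n * n' * n) := by
    have h3 := congrArg (n * ·) E2
    have l : n * (n + n' * n + n * n' * n) = n * n' * n := by
      have : n * (n + n' * n + n * n' * n) = n * n + n * n' * n + n * n * n' * n := by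
        noncomm_ring
      rw [this, hn, zero_add, zero_mul, zero_mul, add_zero]
    have r : n * (c • (n + n' * n)) = c • (n * n' * n) := by
      rw [mul_smul_comm, mul_add, hn, zero_add, mul_assoc]
    simpa only [l, r] using h3
  by_cases hc : c = 1
  · rw [hc, one_smul] at h
    have e3 : (1 + n) * (1 + n') = (1 + n + n') + n * n' := by noncomm_ring
    have e4 : (1 + n') * (1 + n) = (1 + n + n') + n' * n := by noncomm_ring
    rw [e3, e4] at h
    exact add_left_cancel h
  · exfalso
    have h1c : (1 - c) ≠ 0 := sub_ne_zero.mpr (Ne.symm hc)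
    have hnnn : n * n' * n = 0 := by
      have : (1 - c) • (n * n' * n) = 0 := by rw [sub_smul, one_smul, ← E3, sub_self]
      exact (smul_eq_zero.mp this).resolve_left h1c
    have h4 : n + n' * n = 0 := by
      rw [hnnn, add_zero] at E2
      have : (1 - c) • (n + n' * n) = 0 := by rw [sub_smul, one_smul, ← E2, sub_self]
      exact (smul_eq_zero.mp this).resolve_left h1c
    have h5 : n' * n = -n := eq_neg_of_add_eq_zero_right h4
    have h6 : n' * n = 0 := by
      have : n' * (n' * n) = n' * (-n) := by rw [h5]
      rw [← mul_assoc, hn', zero_mul, mul_neg] at this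
      exact neg_eq_zero.mp this.symm
    apply hn0
    rw [h6] at h5
    exact neg_eq_zero.mp h5.symm

/-- The same in the form delivered by `GL2.mk_eq_mk_iff_smul`: if `x = c (1 + n)`,
`y = c' (1 + n')` with `n² = n'² = 0`, `n ≠ 0`, and `u (x y) = y x` for a unit `u`, then
`n n' = n' n`. [folklore] -/
theorem commute_of_smul_mul_eq {x y : GL (Fin 2) k} {c c' : k}
    {n n' : Matrix (Fin 2) (Fin 2) k} (hc : c ≠ 0) (hc' : c' ≠ 0)
    (hn : n * n = 0) (hn' : n' * n' = 0) (hn0 : n ≠ 0)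
    (hx : (x : Matrix (Fin 2) (Fin 2) k) = c • (1 + n))
    (hy : (y : Matrix (Fin 2) (Fin 2) k) = c' • (1 + n')) {u : kˣ}
    (h : (u : k) • ((x : Matrix (Fin 2) (Fin 2) k) * y) = (y : Matrix (Fin 2) (Fin 2) k) * x) :
    n * n' = n' * n := by
  rw [hx, hy, smul_mul_smul_comm, smul_mul_smul_comm, mul_comm c' c, smul_smul] at h
  -- `(u c c') • ((1+n)(1+n')) = (c c') • ((1+n')(1+n))`
  have hcc : c * c' ≠ 0 := mul_ne_zero hc hc'
  have h' : (1 + n) * (1 + n') = ((u : k)⁻¹) • ((1 + n') * (1 + n)) := by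
    have := congrArg ((((u : k) * (c * c'))⁻¹) • ·) h
    rw [smul_smul, inv_mul_cancel₀ (mul_ne_zero u.ne_zero hcc), one_smul, smul_smul,
      mul_inv, mul_assoc, inv_mul_cancel₀ hcc, mul_one] at this
    exact this
  exact commute_of_smul_eq hn hn' hn0 h'

open Matrix.ProjGenLinGroup in
/-- **A conjugation-stable family of pairwise commuting elements of order `p = char k` has a
common eigenvector** (`k` algebraically closed of characteristic `p`).  Let `ρ : G →* GL₂(k)` and
`S ⊆ G` be non-empty, stable under `s ↦ g⁻¹ s g`, with every `\bar ρ(s)` (`s ∈ S`) non-trivial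
of order `p` and `\bar ρ(s) \bar ρ(t) = \bar ρ(t) \bar ρ(s)` for `s, t ∈ S`.  Then `ρ(G)` has a
common eigenvector: `ρ(s₀) = c (1 + n)` is a unipotent class, its eigenline `ker n` is that of
every conjugate `ρ(g)⁻¹ ρ(s₀) ρ(g) = c (1 + ρ(g)⁻¹ n ρ(g))` (they commute projectively, hence
genuinely), so `ρ(g)` preserves it.  This is the positive-characteristic phenomenon behind "a
normal subgroup of order divisible by `p` forces reducibility". [folklore] -/
theorem hasCommonEigenvector_of_unipotents [IsAlgClosed k] {p : ℕ} [Fact p.Prime] [CharP k p]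
    {G : Type*} [Group G] (ρ : G →* GL (Fin 2) k) (S : Set G) (hS : S.Nonempty)
    (hunip : ∀ s ∈ S, mk (ρ s) ≠ 1 ∧ mk (ρ s) ^ p = 1)
    (hcomm : ∀ s ∈ S, ∀ t ∈ S, mk (ρ s) * mk (ρ t) = mk (ρ t) * mk (ρ s))
    (hconj : ∀ g : G, ∀ s ∈ S, g⁻¹ * s * g ∈ S) : HasCommonEigenvector ρ := by
  obtain ⟨s₀, hs₀⟩ := hS
  obtain ⟨c, n, hc, hnn, hX⟩ := exists_eq_smul_one_add_of_mk_pow_char (hunip s₀ hs₀).2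
  have hn0 : n ≠ 0 := by
    intro h0
    apply (hunip s₀ hs₀).1
    rw [Matrix.ProjGenLinGroup.mk_eq_one, GL2.mem_center_iff, hX, h0, add_zero]
    simp
  obtain ⟨v, hv, hnv⟩ := Serre1972.exists_ne_zero_mulVec_eq_zero hn0 hnn
  refine ⟨v, hv, fun g => ?_⟩
  set P : Matrix (Fin 2) (Fin 2) k := ((ρ g : GL (Fin 2) k) : Matrix (Fin 2) (Fin 2) k) with hP
  set Pi : Matrix (Fin 2) (Fin 2) k := (((ρ g)⁻¹ : GL (Fin 2) k) : Matrix (Fin 2) (Fin 2) k)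
    with hPi
  have hPiP : Pi * P = 1 := by
    rw [hPi, hP, ← Matrix.GeneralLinearGroup.coe_mul, inv_mul_cancel,
      Matrix.GeneralLinearGroup.coe_one]
  have hPPi : P * Pi = 1 := by
    rw [hPi, hP, ← Matrix.GeneralLinearGroup.coe_mul, mul_inv_cancel,
      Matrix.GeneralLinearGroup.coe_one]
  -- the conjugate `t = g⁻¹ s₀ g ∈ S`
  have ht : ((ρ (g⁻¹ * s₀ * g) : GL (Fin 2) k) : Matrix (Fin 2) (Fin 2) k) =
      c • (1 + Pi * n * P) := by
    rw [map_mul, map_mul, map_inv, Matrix.GeneralLinearGroup.coe_mul,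
      Matrix.GeneralLinearGroup.coe_mul, ← hPi, ← hP, hX, mul_smul_comm, smul_mul_assoc,
      mul_add, mul_one, add_mul, hPiP]
  have hnt : (Pi * n * P) * (Pi * n * P) = 0 := by
    rw [show Pi * n * P * (Pi * n * P) = Pi * (n * ((P * Pi) * n)) * P by noncomm_ring, hPPi,
      one_mul, hnn, mul_zero, zero_mul]
  have hcomm' := hcomm s₀ hs₀ _ (hconj g s₀ hs₀)
  rw [← map_mul Matrix.ProjGenLinGroup.mk, ← map_mul Matrix.ProjGenLinGroup.mk,
    GL2.mk_eq_mk_iff_smul, Matrix.GeneralLinearGroup.coe_mul,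
    Matrix.GeneralLinearGroup.coe_mul] at hcomm'
  obtain ⟨u, hu⟩ := hcomm'
  have hnc : n * (Pi * n * P) = (Pi * n * P) * n := commute_of_smul_mul_eq hc hc hnn hnt hn0 hX ht hu
  have h1 : (Pi * n * P) *ᵥ v = 0 := CharTwoPGL2.mulVec_eq_zero_of_commute hn0 hnt hnc hv hnv
  have h2 : n *ᵥ (P *ᵥ v) = 0 := by
    have := congrArg (fun z => P *ᵥ z) h1
    simpa only [Matrix.mulVec_mulVec, Matrix.mulVec_zero, ← mul_assoc, hPPi, one_mul] using this
  obtain ⟨a, ha⟩ := Serre1972.exists_eq_smul_of_mulVec_eq_zero hn0 hv hnv h2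
  exact ⟨a, ha⟩

/-- The elements of `𝔖₄` have order at most `4` (`σ⁴ = 1` or `σ³ = 1` for each of the `24`
permutations of `Fin 4`). [folklore] -/
theorem orderOf_perm_fin_four_le (σ : Equiv.Perm (Fin 4)) : orderOf σ ≤ 4 := by
  have key : ∀ τ : Equiv.Perm (Fin 4), τ ^ 4 = 1 ∨ τ ^ 3 = 1 := by
    set_option maxRecDepth 4000 in decide
  rcases key σ with h | h
  · exact orderOf_le_of_pow_eq_one (by norm_num) h
  · exact (orderOf_le_of_pow_eq_one (by norm_num) h).trans (by norm_num)

end PGL2AnyChar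

/-! ### Part 2: the monomial and Klein cases without `char k = 0` -/

section Core

variable {G : Type*} [Group G] {k : Type*} [Field k]

open Matrix.ProjGenLinGroup in
/-- **A non-trivial cyclic normal subgroup of the projective image forces dihedral type**, the
statement of `isDihedralType_of_forall_conj_eq_zpow` with `char k = 0` replaced by "the order of
`\bar ρ(g₀)` is prime to `char k`" (`\bar ρ(g₀) ^ t = 1`, `(t : k) ≠ 0`): after diagonalising
`ρ(g₀)` (`CharTwoPGL2.exists_conj_eq_diagonal_of_mk_pow_eq_one`) every `ρ(g)` is diagonal or
antidiagonal and `isDihedralType_of_monomial` applies. [folklore] -/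
theorem isDihedralType_of_forall_conj_eq_zpow_of_mk_pow_eq_one [Finite G] [IsAlgClosed k]
    (ρ : G →* GL (Fin 2) k) (hce : ¬ HasCommonEigenvector ρ) {g₀ : G}
    (h₀ : ρ g₀ ∉ center (GL (Fin 2) k)) {t : ℕ} (ht : (t : k) ≠ 0) (hg₀t : mk (ρ g₀) ^ t = 1)
    (hN : ∀ g, ∃ j : ℤ,
      Matrix.ProjGenLinGroup.mk (ρ g) * Matrix.ProjGenLinGroup.mk (ρ g₀) =
        Matrix.ProjGenLinGroup.mk (ρ g₀) ^ j * Matrix.ProjGenLinGroup.mk (ρ g)) :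
    IsDihedralType ρ := by
  -- diagonalise `ρ g₀`
  obtain ⟨Q, d, hd, hQ⟩ := CharTwoPGL2.exists_conj_eq_diagonal_of_mk_pow_eq_one (ρ g₀) ht hg₀t h₀
  set ρ' := conjGL Q⁻¹ ρ with hρ'
  have hy : ((ρ' g₀ : GL (Fin 2) k) : Matrix (Fin 2) (Fin 2) k) = diagonal d := by
    rw [hρ', conjGL_apply, inv_inv]
    exact hQ
  have hy' : ρ' g₀ ∈ (GL2.dgUnits : Subgroup (GL (Fin 2) k)) := by
    rw [GL2.mem_dgUnits, hy]
    exact GL2.isDg_diagonal d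
  -- the relation transported to `ρ'`
  have hN' : ∀ g, ∃ j : ℤ,
      Matrix.ProjGenLinGroup.mk (ρ' g) * Matrix.ProjGenLinGroup.mk (ρ' g₀) =
        Matrix.ProjGenLinGroup.mk (ρ' g₀) ^ j * Matrix.ProjGenLinGroup.mk (ρ' g) := by
    intro g
    obtain ⟨j, hj⟩ := hN g
    refine ⟨j, ?_⟩
    have := congrArg (MulAut.conj (Matrix.ProjGenLinGroup.mk Q⁻¹)) hj
    rw [map_mul, map_mul, map_zpow] at this
    simpa only [hρ', mk_conjGL] using this
  have hmono : ∀ g, GL2.IsDg ((ρ' g : GL (Fin 2) k) : Matrix (Fin 2) (Fin 2) k) ∨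
      GL2.IsAd ((ρ' g : GL (Fin 2) k) : Matrix (Fin 2) (Fin 2) k) := by
    intro g
    obtain ⟨j, hj⟩ := hN' g
    rw [← map_zpow, ← map_mul Matrix.ProjGenLinGroup.mk, ← map_mul Matrix.ProjGenLinGroup.mk,
      GL2.mk_eq_mk_iff_smul] at hj
    obtain ⟨u, hu⟩ := hj
    rw [Matrix.GeneralLinearGroup.coe_mul, Matrix.GeneralLinearGroup.coe_mul, hy] at hu
    have hdg : GL2.IsDg ((u : k)⁻¹ •
        ((ρ' g₀ ^ j : GL (Fin 2) k) : Matrix (Fin 2) (Fin 2) k)) :=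
      (GL2.mem_dgUnits.mp (GL2.dgUnits.zpow_mem hy' j)).smul _
    have key : ((ρ' g : GL (Fin 2) k) : Matrix (Fin 2) (Fin 2) k) * diagonal d =
        diagonal ![((u : k)⁻¹ • ((ρ' g₀ ^ j : GL (Fin 2) k) : Matrix (Fin 2) (Fin 2) k)) 0 0,
          ((u : k)⁻¹ • ((ρ' g₀ ^ j : GL (Fin 2) k) : Matrix (Fin 2) (Fin 2) k)) 1 1] *
          ((ρ' g : GL (Fin 2) k) : Matrix (Fin 2) (Fin 2) k) := by
      rw [← hdg.eq_diagonal, smul_mul_assoc, ← hu, smul_smul, inv_mul_cancel₀ u.ne_zero,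
        one_smul]
    exact GL2.isDg_or_isAd_of_mul_diagonal (GL2.det_ne_zero _) hd key
  have hDex : ∃ g, GL2.IsDg ((ρ' g : GL (Fin 2) k) : Matrix (Fin 2) (Fin 2) k) ∧
      ((ρ' g : GL (Fin 2) k) : Matrix (Fin 2) (Fin 2) k) 0 0 ≠
        ((ρ' g : GL (Fin 2) k) : Matrix (Fin 2) (Fin 2) k) 1 1 :=
    ⟨g₀, by rw [hy]; exact GL2.isDg_diagonal d, by rw [hy]; simpa using hd⟩
  have hAex : ∃ g, GL2.IsAd ((ρ' g : GL (Fin 2) k) : Matrix (Fin 2) (Fin 2) k) := by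
    by_contra hA
    push Not at hA
    exact hce (HasCommonEigenvector.of_conjGL (P := Q⁻¹)
      (hasCommonEigenvector_of_forall_isDg fun g => (hmono g).resolve_right (hA g)))
  exact isDihedralType_of_conjGL (isDihedralType_of_monomial ρ' hmono hDex hAex)

open Matrix.ProjGenLinGroup in
/-- **The Klein four-group case** with `char k = 0` weakened to `2 ≠ 0` in `k`: the statement of
`projectiveType_of_klein` under `[NeZero (2 : k)]`.  Let `y = ρ(g_y) = diag(d, -d)`,
`x = ρ(g_x)` antidiagonal, and `N` an abelian normal subgroup of the projective image containing
`\bar x`, `\bar y`.  Then `N = {1, \bar x, \bar y, \bar x \bar y}` is a self-centralising normal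
Klein four-subgroup (Lemma K, `GL2.mk_mem_klein`), so `[\bar ρ(G) : N] ∣ 6`; order `12` gives
`𝔄₄`, order `24` gives `𝔖₄`, and orders `4`, `8` give a `2`-group with non-trivial centre,
whence dihedral type by `isDihedralType_of_forall_conj_eq_zpow_of_mk_pow_eq_one` (a central
element has `2`-power order, prime to `char k ≠ 2`). [folklore] -/
theorem projectiveType_of_klein_of_neZero_two [Finite G] [IsAlgClosed k] [NeZero (2 : k)]
    (ρ : G →* GL (Fin 2) k)
    (hce : ¬ HasCommonEigenvector ρ) {gy gx : G} {d : Fin 2 → k}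
    (hy : ((ρ gy : GL (Fin 2) k) : Matrix (Fin 2) (Fin 2) k) = diagonal d) (hd : d 1 = -d 0)
    (hx : GL2.IsAd ((ρ gx : GL (Fin 2) k) : Matrix (Fin 2) (Fin 2) k))
    (N : Subgroup (projectiveImage ρ)) [N.Normal] (hab : ∀ a ∈ N, ∀ b ∈ N, a * b = b * a)
    (hyN : (⟨mk (ρ gy), gy, rfl⟩ : projectiveImage ρ) ∈ N)
    (hxN : (⟨mk (ρ gx), gx, rfl⟩ : projectiveImage ρ) ∈ N) :
    IsDihedralType ρ ∨ IsTetrahedralType ρ ∨ IsOctahedralType ρ := by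
  classical
  haveI := finite_range_of_finite ρ
  haveI : Finite (projectiveImage ρ) := finite_projectiveImage_of_finite_range ρ
  set yb : projectiveImage ρ := ⟨mk (ρ gy), gy, rfl⟩ with hyb
  set xb : projectiveImage ρ := ⟨mk (ρ gx), gx, rfl⟩ with hxb
  have hd0 : d 0 ≠ 0 := by
    intro h0
    apply GL2.det_ne_zero (ρ gy)
    rw [hy, det_diagonal, Fin.prod_univ_two, h0, zero_mul]
  -- Lemma K inside the projective image
  have hK : ∀ w : projectiveImage ρ, w * yb = yb * w → w * xb = xb * w →
      w = 1 ∨ w = xb ∨ w = yb ∨ w = xb * yb := by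
    intro w hwy hwx
    obtain ⟨w₀, hw₀⟩ := mk_surjective (w : PGL(2, k))
    have hwy' := congrArg Subtype.val hwy
    have hwx' := congrArg Subtype.val hwx
    rw [Subgroup.coe_mul, Subgroup.coe_mul, ← hw₀] at hwy' hwx'
    change mk w₀ * mk (ρ gy) = mk (ρ gy) * mk w₀ at hwy'
    change mk w₀ * mk (ρ gx) = mk (ρ gx) * mk w₀ at hwx'
    rcases GL2.mk_mem_klein hy hd hx hwy' hwx' with h | h | h | h
    · exact Or.inl (Subtype.ext (hw₀.symm.trans h))
    · exact Or.inr (Or.inl (Subtype.ext (hw₀.symm.trans h)))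
    · exact Or.inr (Or.inr (Or.inl (Subtype.ext (hw₀.symm.trans h))))
    · exact Or.inr (Or.inr (Or.inr (Subtype.ext (hw₀.symm.trans h))))
  -- the four elements are distinct involutions
  have hx1 : xb ≠ 1 := by
    intro h
    have h' : mk (ρ gx) = 1 := congrArg Subtype.val h
    rw [Matrix.ProjGenLinGroup.mk_eq_one] at h'
    exact hx.not_isDg (GL2.det_ne_zero _) (GL2.isDg_of_mem_center h')
  have hy1 : yb ≠ 1 := by
    intro h
    have h' : mk (ρ gy) = 1 := congrArg Subtype.val h
    rw [Matrix.ProjGenLinGroup.mk_eq_one, GL2.mem_center_iff, hy] at h'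
    have h'' : d 0 = d 1 := by simpa using h'.2.2
    rw [hd] at h''
    have : (2 : k) * d 0 = 0 := by linear_combination h''
    exact (mul_ne_zero two_ne_zero hd0) this
  have hxy : xb ≠ yb := by
    intro h
    have h' : mk (ρ gx) = mk (ρ gy) := congrArg Subtype.val h
    rw [GL2.mk_eq_mk_iff_smul, hy] at h'
    obtain ⟨u, hu⟩ := h'
    have := congr_fun (congr_fun hu 0) 0
    simp only [Matrix.smul_apply, hx.1, smul_eq_mul, mul_zero, diagonal_apply_eq] at this
    exact hd0 this.symm
  have hxx : xb * xb = 1 := Subtype.ext (GL2.mk_mul_mk_self_eq_one hx.mul_self)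
  have hyy : yb * yb = 1 := by
    refine Subtype.ext (GL2.mk_mul_mk_self_eq_one (t := d 0 ^ 2) ?_)
    rw [hy, diagonal_mul_diagonal]
    ext i j
    fin_cases i <;> fin_cases j <;> simp [hd] <;> ring
  have hcomm : xb * yb = yb * xb := hab _ hxN _ hyN
  have hxyxy : xb * yb * (xb * yb) = 1 := by
    calc xb * yb * (xb * yb) = xb * (yb * xb) * yb := by group
      _ = xb * (xb * yb) * yb := by rw [hcomm]
      _ = (xb * xb) * (yb * yb) := by group
      _ = 1 := by rw [hxx, hyy, one_mul]
  have hxy1 : xb * yb ≠ 1 := by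
    intro h
    apply hxy
    calc xb = xb * (yb * yb) := by rw [hyy, mul_one]
      _ = xb * yb * yb := by group
      _ = yb := by rw [h, one_mul]
  have hxyx : xb * yb ≠ xb := fun h => hy1 (mul_left_cancel (h.trans (mul_one xb).symm))
  have hxyy : xb * yb ≠ yb := fun h => hx1 (mul_right_cancel (h.trans (one_mul yb).symm))
  -- `N = {1, xb, yb, xbyb}`
  have hNsub : ∀ w ∈ N, w = 1 ∨ w = xb ∨ w = yb ∨ w = xb * yb := fun w hw =>
    hK w (hab w hw yb hyN) (hab w hw xb hxN)
  have hset : (N : Set (projectiveImage ρ)) = {1, xb, yb, xb * yb} := by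
    ext w
    simp only [SetLike.mem_coe, Set.mem_insert_iff, Set.mem_singleton_iff]
    constructor
    · exact hNsub w
    · rintro (rfl | rfl | rfl | rfl)
      exacts [N.one_mem, hxN, hyN, N.mul_mem hxN hyN]
  have hcard : Nat.card N = 4 := by
    rw [← SetLike.coe_sort_coe, hset, Nat.card_coe_set_eq,
      show ({1, xb, yb, xb * yb} : Set (projectiveImage ρ)) =
        ↑({1, xb, yb, xb * yb} : Finset (projectiveImage ρ)) by simp, Set.ncard_coe_finset,
      Finset.card_insert_of_notMem, Finset.card_insert_of_notMem, Finset.card_pair hxyy.symm]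
    · simp only [Finset.mem_insert, Finset.mem_singleton, not_or]
      exact ⟨hxy, hxyx.symm⟩
    · simp only [Finset.mem_insert, Finset.mem_singleton, not_or]
      exact ⟨hx1.symm, hy1.symm, hxy1.symm⟩
  -- `N` is a self-centralising normal Klein four-subgroup
  haveI : Nontrivial N := ⟨⟨⟨xb, hxN⟩, 1, fun h => hx1 (congrArg Subtype.val h)⟩⟩
  haveI : IsKleinFour N := ⟨hcard, by
    rw [Monoid.exponent_eq_prime_iff Nat.prime_two]
    rintro ⟨g, hg⟩ hg1
    apply orderOf_eq_prime _ hg1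
    apply Subtype.ext
    show g ^ 2 = 1
    rw [pow_two]
    rcases hNsub g hg with rfl | rfl | rfl | rfl
    exacts [one_mul 1, hxx, hyy, hxyxy]⟩
  have hC : centralizer (N : Set (projectiveImage ρ)) ≤ N := by
    intro w hw
    rw [Subgroup.mem_centralizer_iff] at hw
    rcases hK w (hw yb hyN).symm (hw xb hxN).symm with rfl | rfl | rfl | rfl
    exacts [N.one_mem, hxN, hyN, N.mul_mem hxN hyN]
  have hCeq : centralizer (N : Set (projectiveImage ρ)) = N :=
    le_antisymm hC fun w hw => Subgroup.mem_centralizer_iff.mpr fun h hh => hab h hh w hw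
  -- `[\bar ρ(G) : N] ∣ 6`
  have hidx : N.index ∣ 6 := by
    have := ConjIndex.index_centralizer_dvd_factorial N
    rwa [hCeq, hcard] at this
  have hPH : Nat.card (projectiveImage ρ) = N.index * 4 := by
    rw [← hcard]; exact (Subgroup.index_mul_card N).symm
  -- orders `4`, `8`: non-trivial centre ⇒ dihedral
  have h2grp : ∀ m : ℕ, Nat.card (projectiveImage ρ) = 2 ^ m → IsDihedralType ρ := by
    intro m hm
    have hp : IsPGroup 2 (projectiveImage ρ) := IsPGroup.of_card hm
    haveI : Nontrivial (projectiveImage ρ) := ⟨⟨xb, 1, hx1⟩⟩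
    haveI := hp.center_nontrivial
    obtain ⟨⟨z, hz⟩, hz1⟩ := exists_ne (1 : center (projectiveImage ρ))
    have hz1' : z ≠ 1 := fun h => hz1 (Subtype.ext h)
    obtain ⟨g₀, hg₀⟩ := z.2
    have hg₀' : mk (ρ g₀) = (z : PGL(2, k)) := hg₀
    have h₀ : ρ g₀ ∉ center (GL (Fin 2) k) := by
      intro h
      apply hz1'
      apply Subtype.ext
      rw [OneMemClass.coe_one, ← hg₀']
      exact Matrix.ProjGenLinGroup.mk_eq_one.mpr h
    -- `z` has `2`-power order, prime to `char k`
    obtain ⟨j, hj⟩ := hp z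
    have ht : ((2 ^ j : ℕ) : k) ≠ 0 := by
      rw [Nat.cast_pow, Nat.cast_two]
      exact pow_ne_zero _ two_ne_zero
    have hzt : mk (ρ g₀) ^ (2 ^ j) = 1 := by
      rw [hg₀', ← Subgroup.coe_pow, hj, OneMemClass.coe_one]
    refine isDihedralType_of_forall_conj_eq_zpow_of_mk_pow_eq_one ρ hce h₀ ht hzt fun g => ⟨1, ?_⟩
    rw [zpow_one, hg₀']
    exact congrArg Subtype.val (Subgroup.mem_center_iff.mp hz ⟨mk (ρ g), g, rfl⟩)
  have hi0 : 0 < N.index := Nat.pos_of_dvd_of_pos hidx (by norm_num)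
  have hi6 : N.index ≤ 6 := Nat.le_of_dvd (by norm_num) hidx
  obtain ⟨i, hi⟩ : ∃ i, N.index = i := ⟨_, rfl⟩
  rw [hi] at hidx hPH hi0 hi6
  interval_cases i
  · exact Or.inl (h2grp 2 (by rw [hPH]; norm_num))
  · exact Or.inl (h2grp 3 (by rw [hPH]; norm_num))
  · exact Or.inr (Or.inl (KleinS4.nonempty_mulEquiv_alternatingGroup_fin_four hC (by rw [hPH])))
  · exact absurd hidx (by decide)
  · exact absurd hidx (by decide)
  · exact Or.inr (Or.inr (KleinS4.nonempty_mulEquiv_perm_fin_four hC (by rw [hPH])))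

/-! ### Part 3: the solvable case in arbitrary characteristic -/

open Matrix.ProjGenLinGroup in
/-- **Solvable Klein, finite group version, arbitrary characteristic.**  For a finite group `G`
and `ρ : G →* GL₂(k)` (`k` algebraically closed, any characteristic) without common eigenvector
and with solvable projective image, the projective image is dihedral `D_m` (`m ≥ 2`), `𝔄₄` or
`𝔖₄`.  Proof: let `M` be the last non-trivial term of the derived series of `\bar ρ(G)`
(abelian, normal).  **No element of `M` has order `char k`**: otherwise the elements of order
`p = char k` of `M` would be a conjugation-stable commuting family of unipotent classes with a
common eigenvector (`PGL2AnyChar.hasCommonEigenvector_of_unipotents`).  Hence the non-trivial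
elements of `M` diagonalise; if `M` is cyclic,
`isDihedralType_of_forall_conj_eq_zpow_of_mk_pow_eq_one` applies; otherwise the elements of
`M` have diagonal or antidiagonal lifts, not all diagonal, an antidiagonal `\bar x ∈ M` is an
involution (so `2 ≠ char k`) commuting with `\bar y`, which forces `y ∼ diag(d, -d)`, and
`projectiveType_of_klein_of_neZero_two` concludes.  This is the solvable case of Dickson's
classification of the finite subgroups of `PGL₂(k̄)`.
[cite: Huppert1967, Kap. II, §8, Hauptsatz 8.27] -/
theorem projectiveType_of_not_hasCommonEigenvector_anyChar [Finite G] [IsAlgClosed k]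
    (ρ : G →* GL (Fin 2) k) (hce : ¬ HasCommonEigenvector ρ)
    (hs : IsSolvable (projectiveImage ρ)) :
    IsDihedralType ρ ∨ IsTetrahedralType ρ ∨ IsOctahedralType ρ := by
  classical
  haveI := finite_range_of_finite ρ
  haveI : Finite (projectiveImage ρ) := finite_projectiveImage_of_finite_range ρ
  -- some `ρ g` is not scalar
  have hnt : ∃ g, mk (ρ g) ≠ 1 := by
    by_contra h
    push Not at h
    exact hce (hasCommonEigenvector_of_forall_isDg fun g =>
      GL2.isDg_of_mem_center (Matrix.ProjGenLinGroup.mk_eq_one.mp (h g)))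
  -- the last non-trivial term `M` of the derived series
  obtain ⟨⟨n, hn⟩⟩ := hs
  have hex : ∃ m, derivedSeries (projectiveImage ρ) m = ⊥ := ⟨n, hn⟩
  obtain ⟨n₀, hn₀spec, hn₀min⟩ :
      ∃ n₀, derivedSeries (projectiveImage ρ) n₀ = ⊥ ∧
        ∀ m < n₀, derivedSeries (projectiveImage ρ) m ≠ ⊥ :=
    ⟨Nat.find hex, Nat.find_spec hex, fun m hm => Nat.find_min hex hm⟩
  have hn₀pos : n₀ ≠ 0 := by
    rintro rfl
    rw [derivedSeries_zero] at hn₀spec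
    obtain ⟨g, hg⟩ := hnt
    have : (⟨mk (ρ g), g, rfl⟩ : projectiveImage ρ) ∈
        (⊤ : Subgroup (projectiveImage ρ)) := mem_top _
    rw [hn₀spec, mem_bot] at this
    exact hg (congrArg Subtype.val this)
  set M := derivedSeries (projectiveImage ρ) (n₀ - 1) with hM
  have hMbot : M ≠ ⊥ := hn₀min (n₀ - 1) (by omega)
  haveI hMn : M.Normal := derivedSeries_normal _ _
  have hMab : ∀ a ∈ M, ∀ b ∈ M, a * b = b * a := by
    intro a ha b hb
    have h := commutator_mem_commutator ha hb
    rw [← derivedSeries_succ, show n₀ - 1 + 1 = n₀ by omega, hn₀spec, mem_bot,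
      commutatorElement_eq_one_iff_mul_comm] at h
    exact h
  -- Step 1: no element of `M` has order `char k`; all orders in `M` are prime to `char k`
  have hMord : ∀ y ∈ M, ((orderOf y : ℕ) : k) ≠ 0 := by
    intro y hyM h0
    obtain ⟨p, hpchar⟩ := CharP.exists k
    have hpdvd : p ∣ orderOf y := (CharP.cast_eq_zero_iff k p _).mp h0
    rcases CharP.char_is_prime_or_zero k p with hp | hp
    · haveI : Fact p.Prime := ⟨hp⟩
      have hu : orderOf (y ^ (orderOf y / p)) = p :=
        orderOf_pow_orderOf_div (orderOf_pos y).ne' hpdvd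
      set u : projectiveImage ρ := y ^ (orderOf y / p) with hu_def
      have huM : u ∈ M := M.pow_mem hyM _
      have hu1 : u ≠ 1 := by
        intro h
        rw [h, orderOf_one] at hu
        exact hp.one_lt.ne hu
      have hup : u ^ p = 1 := by rw [← hu]; exact pow_orderOf_eq_one u
      apply hce
      let S : Set G := {g | (⟨mk (ρ g), g, rfl⟩ : projectiveImage ρ) ∈ M ∧ mk (ρ g) ≠ 1 ∧
        mk (ρ g) ^ p = 1}
      have hSmem : ∀ g, g ∈ S ↔ ((⟨mk (ρ g), g, rfl⟩ : projectiveImage ρ) ∈ M ∧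
          mk (ρ g) ≠ 1 ∧ mk (ρ g) ^ p = 1) := fun g => Iff.rfl
      refine PGL2AnyChar.hasCommonEigenvector_of_unipotents ρ S ?_ ?_ ?_ ?_
      · obtain ⟨gu, hgu⟩ := u.2
        refine ⟨gu, (hSmem gu).2 ⟨?_, ?_, ?_⟩⟩
        · have : (⟨mk (ρ gu), gu, rfl⟩ : projectiveImage ρ) = u := Subtype.ext hgu
          rw [this]; exact huM
        · intro h
          apply hu1
          exact Subtype.ext (by rw [OneMemClass.coe_one, ← hgu]; exact h)
        · have := congrArg Subtype.val hup
          rw [Subgroup.coe_pow, OneMemClass.coe_one, ← hgu] at this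
          exact this
      · intro s hs
        exact ⟨((hSmem s).1 hs).2.1, ((hSmem s).1 hs).2.2⟩
      · intro s hs t ht
        exact congrArg Subtype.val (hMab _ ((hSmem s).1 hs).1 _ ((hSmem t).1 ht).1)
      · intro g s hs
        obtain ⟨hsM, hs1, hsp⟩ := (hSmem s).1 hs
        refine (hSmem _).2 ⟨?_, ?_, ?_⟩
        · have hconj := hMn.conj_mem _ hsM (⟨mk (ρ g), g, rfl⟩ : projectiveImage ρ)⁻¹
          convert hconj using 1
          apply Subtype.ext
          simp only [map_mul, map_inv, Subgroup.coe_mul, Subgroup.coe_inv, inv_inv]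
        · intro h
          apply hs1
          simp only [map_mul, map_inv] at h
          have h4 : mk (ρ s) =
              mk (ρ g) * ((mk (ρ g))⁻¹ * mk (ρ s) * mk (ρ g)) * (mk (ρ g))⁻¹ := by group
          rw [h4, h, mul_one, mul_inv_cancel]
        · simp only [map_mul, map_inv]
          have h3 : (mk (ρ g))⁻¹ * mk (ρ s) * mk (ρ g) = MulAut.conj (mk (ρ g))⁻¹ (mk (ρ s)) := by
            rw [MulAut.conj_apply, inv_inv]
          rw [h3, ← map_pow, hsp, map_one]
    · subst hp
      haveI := CharP.charP_to_charZero k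
      exact (Nat.cast_ne_zero.mpr (orderOf_pos y).ne') h0
  by_cases hcyc : IsCyclic M
  · -- Case A: `M = ⟨c⟩` cyclic and normal ⇒ dihedral
    obtain ⟨c, hcM⟩ := (M.isCyclic_iff_exists_zpowers_eq_top).mp hcyc
    have hc1 : c ≠ 1 := by
      rintro rfl
      apply hMbot
      rw [← hcM, zpowers_one_eq_bot]
    have hcmem : c ∈ M := by rw [← hcM]; exact mem_zpowers c
    obtain ⟨g₀, hg₀⟩ := c.2
    have hg₀' : mk (ρ g₀) = (c : PGL(2, k)) := hg₀
    have h₀ : ρ g₀ ∉ center (GL (Fin 2) k) := by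
      intro h
      apply hc1
      apply Subtype.ext
      rw [OneMemClass.coe_one, ← hg₀']
      exact Matrix.ProjGenLinGroup.mk_eq_one.mpr h
    have hct : mk (ρ g₀) ^ orderOf c = 1 := by
      rw [hg₀', ← Subgroup.coe_pow, pow_orderOf_eq_one, OneMemClass.coe_one]
    left
    refine isDihedralType_of_forall_conj_eq_zpow_of_mk_pow_eq_one ρ hce h₀ (hMord c hcmem) hct
      fun g => ?_
    have hmem :
        (⟨mk (ρ g), g, rfl⟩ : projectiveImage ρ) * c * (⟨mk (ρ g), g, rfl⟩)⁻¹ ∈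
          zpowers c := by
      rw [hcM]
      exact hMn.conj_mem c hcmem _
    obtain ⟨j, hj⟩ := mem_zpowers_iff.mp hmem
    refine ⟨j, ?_⟩
    have hj' := congrArg Subtype.val hj
    simp only [Subgroup.coe_zpow, Subgroup.coe_mul, Subgroup.coe_inv] at hj'
    rw [hg₀', hj', inv_mul_cancel_right]
  · -- Case B: `M` abelian, normal, not cyclic
    obtain ⟨y, hyM, hy1⟩ : ∃ y ∈ M, y ≠ (1 : projectiveImage ρ) :=
      (M.bot_or_exists_ne_one).resolve_left hMbot
    obtain ⟨gy, hgy⟩ := y.2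
    have hgy' : mk (ρ gy) = (y : PGL(2, k)) := hgy
    have hy₀ : ρ gy ∉ center (GL (Fin 2) k) := by
      intro h
      apply hy1
      apply Subtype.ext
      rw [OneMemClass.coe_one, ← hgy']
      exact Matrix.ProjGenLinGroup.mk_eq_one.mpr h
    -- diagonalise `ρ gy` (its projective order is prime to `char k`)
    have hyt : mk (ρ gy) ^ orderOf y = 1 := by
      rw [hgy', ← Subgroup.coe_pow, pow_orderOf_eq_one, OneMemClass.coe_one]
    obtain ⟨Q, d, hd, hQ⟩ :=
      CharTwoPGL2.exists_conj_eq_diagonal_of_mk_pow_eq_one (ρ gy) (hMord y hyM) hyt hy₀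
    set ρ' := conjGL Q⁻¹ ρ with hρ'
    have hyd : ((ρ' gy : GL (Fin 2) k) : Matrix (Fin 2) (Fin 2) k) = diagonal d := by
      rw [hρ', conjGL_apply, inv_inv]
      exact hQ
    haveI := finite_range_of_finite ρ'
    haveI : Finite (projectiveImage ρ') := finite_projectiveImage_of_finite_range ρ'
    -- transport `M`
    set e := projectiveImageConjEquiv Q⁻¹ ρ with he
    set M' : Subgroup (projectiveImage ρ') :=
      M.map (e : projectiveImage ρ →* projectiveImage ρ') with hM'
    haveI hM'n : M'.Normal := Subgroup.Normal.map hMn _ e.surjective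
    have hM'ab : ∀ a ∈ M', ∀ b ∈ M', a * b = b * a := by
      rintro _ ⟨a, ha, rfl⟩ _ ⟨b, hb, rfl⟩
      rw [← map_mul, ← map_mul, hMab a ha b hb]
    have hM'cyc : ¬ IsCyclic M' := fun h =>
      hcyc (isCyclic_of_surjective (e.subgroupMap M).symm.toMonoidHom
        (e.subgroupMap M).symm.surjective)
    have hM'ord : ∀ a ∈ M', ((orderOf a : ℕ) : k) ≠ 0 := by
      rintro _ ⟨a, ha, rfl⟩
      have : orderOf ((e : projectiveImage ρ →* projectiveImage ρ') a) = orderOf a :=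
        MulEquiv.orderOf_eq e a
      rw [this]
      exact hMord a ha
    have hyM' : (⟨mk (ρ' gy), gy, rfl⟩ : projectiveImage ρ') ∈ M' := by
      refine ⟨y, hyM, Subtype.ext ?_⟩
      show ((e y : projectiveImage ρ') : PGL(2, k)) = mk (ρ' gy)
      rw [he, coe_projectiveImageConjEquiv, hρ', mk_conjGL, MulAut.conj_apply, hgy']
    -- elements of `M'` have diagonal or antidiagonal lifts
    have hshape : ∀ g, (⟨mk (ρ' g), g, rfl⟩ : projectiveImage ρ') ∈ M' →
        GL2.IsDg ((ρ' g : GL (Fin 2) k) : Matrix (Fin 2) (Fin 2) k) ∨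
          GL2.IsAd ((ρ' g : GL (Fin 2) k) : Matrix (Fin 2) (Fin 2) k) := by
      intro g hg
      have h' := congrArg Subtype.val (hM'ab _ hg _ hyM')
      change mk (ρ' g) * mk (ρ' gy) = mk (ρ' gy) * mk (ρ' g) at h'
      rw [← map_mul Matrix.ProjGenLinGroup.mk, ← map_mul Matrix.ProjGenLinGroup.mk,
        GL2.mk_eq_mk_iff_smul, Matrix.GeneralLinearGroup.coe_mul,
        Matrix.GeneralLinearGroup.coe_mul, hyd] at h'
      obtain ⟨u, hu⟩ := h'
      have key : ((ρ' g : GL (Fin 2) k) : Matrix (Fin 2) (Fin 2) k) * diagonal d =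
          diagonal ((u : k)⁻¹ • d) * ((ρ' g : GL (Fin 2) k) : Matrix (Fin 2) (Fin 2) k) := by
        rw [diagonal_smul, smul_mul_assoc, ← hu, smul_smul, inv_mul_cancel₀ u.ne_zero,
          one_smul]
      exact GL2.isDg_or_isAd_of_mul_diagonal (GL2.det_ne_zero _) hd key
    -- not all diagonal, since `M'` is not cyclic
    have hxex : ∃ gx, (⟨mk (ρ' gx), gx, rfl⟩ : projectiveImage ρ') ∈ M' ∧
        GL2.IsAd ((ρ' gx : GL (Fin 2) k) : Matrix (Fin 2) (Fin 2) k) := by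
      by_contra hno
      push Not at hno
      apply hM'cyc
      let D : Subgroup G := M'.comap (mk.comp ρ').rangeRestrict
      have hDmem : ∀ g, g ∈ D ↔ (⟨mk (ρ' g), g, rfl⟩ : projectiveImage ρ') ∈ M' :=
        fun g => Iff.rfl
      have hDdg : D ≤ dgSubgroup ρ' := fun g hg =>
        (hshape g ((hDmem g).mp hg)).resolve_right (hno g ((hDmem g).mp hg))
      obtain ⟨g₁, hg₁D, hgen⟩ := exists_projective_generator_of_le_dgSubgroup ρ' D hDdg
      rw [Subgroup.isCyclic_iff_exists_zpowers_eq_top]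
      refine ⟨⟨mk (ρ' g₁), g₁, rfl⟩,
        le_antisymm (zpowers_le.mpr ((hDmem g₁).mp hg₁D)) ?_⟩
      rintro ⟨_, g, rfl⟩ hg
      obtain ⟨j, hj⟩ := hgen g ((hDmem g).mpr hg)
      exact mem_zpowers_iff.mpr ⟨j, Subtype.ext (by simp [hj])⟩
    obtain ⟨gx, hxM', hx⟩ := hxex
    -- `\bar x` is an involution of `M'`, so `2 ≠ 0` in `k`
    have htwo : (2 : k) ≠ 0 := by
      set xb : projectiveImage ρ' := ⟨mk (ρ' gx), gx, rfl⟩ with hxb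
      have hxx : xb * xb = 1 := Subtype.ext (GL2.mk_mul_mk_self_eq_one hx.mul_self)
      have hx1 : xb ≠ 1 := by
        intro h
        have h' : mk (ρ' gx) = 1 := congrArg Subtype.val h
        rw [Matrix.ProjGenLinGroup.mk_eq_one] at h'
        exact hx.not_isDg (GL2.det_ne_zero _) (GL2.isDg_of_mem_center h')
      have hord : orderOf xb = 2 := orderOf_eq_prime (by rw [pow_two]; exact hxx) hx1
      have h2 := hM'ord xb hxM'
      rw [hord, Nat.cast_two] at h2
      exact h2
    haveI : NeZero (2 : k) := ⟨htwo⟩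
    -- `\bar x \bar y = \bar y \bar x` forces `d 1 = -d 0`
    have hd' : d 1 = -d 0 := by
      have h' := congrArg Subtype.val (hM'ab _ hxM' _ hyM')
      change mk (ρ' gx) * mk (ρ' gy) = mk (ρ' gy) * mk (ρ' gx) at h'
      rw [← map_mul Matrix.ProjGenLinGroup.mk, ← map_mul Matrix.ProjGenLinGroup.mk,
        GL2.mk_eq_mk_iff_smul, Matrix.GeneralLinearGroup.coe_mul,
        Matrix.GeneralLinearGroup.coe_mul, hyd, hx.mul_diagonal] at h'
      obtain ⟨u, hu⟩ := h'
      obtain ⟨hx01, hx10⟩ := hx.entry_ne_zero (GL2.det_ne_zero _)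
      have e01 := congr_fun (congr_fun hu 0) 1
      have e10 := congr_fun (congr_fun hu 1) 0
      simp only [Matrix.smul_apply, diagonal_mul, smul_eq_mul, Matrix.cons_val_zero,
        Matrix.cons_val_one] at e01 e10
      have h1 : (u : k) * d 1 = d 0 := by
        have : ((u : k) * d 1 - d 0) * ((ρ' gx : GL (Fin 2) k) : Matrix (Fin 2) (Fin 2) k) 0 1 =
            0 := by
          linear_combination e01
        exact sub_eq_zero.mp ((mul_eq_zero.mp this).resolve_right hx01)
      have h2 : (u : k) * d 0 = d 1 := by
        have : ((u : k) * d 0 - d 1) * ((ρ' gx : GL (Fin 2) k) : Matrix (Fin 2) (Fin 2) k) 1 0 =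
            0 := by
          linear_combination e10
        exact sub_eq_zero.mp ((mul_eq_zero.mp this).resolve_right hx10)
      have hd0 : d 0 ≠ 0 := by
        intro h0
        apply GL2.det_ne_zero (ρ' gy)
        rw [hyd, det_diagonal, Fin.prod_univ_two, h0, zero_mul]
      have hu2 : (u : k) ^ 2 = 1 := by
        have : ((u : k) ^ 2 - 1) * d 0 = 0 := by linear_combination (u : k) * h2 + h1
        exact sub_eq_zero.mp ((mul_eq_zero.mp this).resolve_right hd0)
      rcases sq_eq_one_iff.mp hu2 with h | h
      · rw [h, one_mul] at h1
        exact absurd h1.symm hd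
      · rw [h, neg_one_mul] at h2
        exact h2.symm
    have hce' : ¬ HasCommonEigenvector ρ' := fun h => hce h.of_conjGL
    rcases projectiveType_of_klein_of_neZero_two ρ' hce' hyd hd' hx M' hM'ab hyM' hxM' with
      h | h | h
    · exact Or.inl (isDihedralType_of_conjGL h)
    · exact Or.inr (Or.inl (isTetrahedralType_of_conjGL h))
    · exact Or.inr (Or.inr (isOctahedralType_of_conjGL h))

end Core

/-! ### Part 4: main results -/

section Main

variable {G : Type*} [Group G] {k : Type*} [Field k] [IsAlgClosed k]

/-- **The solvable case of Dickson's classification, arbitrary characteristic.**  Let `k` be an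
algebraically closed field (of any characteristic) and `ρ : G →* GL₂(k)` a homomorphism with
finite solvable image whose standard representation on `k²` is irreducible.  Then the projective
image `\bar ρ(G) ≤ PGL₂(k)` is dihedral `D_m` (`m ≥ 2`), tetrahedral (`≅ 𝔄₄`) or octahedral
(`≅ 𝔖₄`): the statement of `isDihedralType_or_isTetrahedralType_or_isOctahedralType`
(`ProjectiveTypeSolvable`, `char k = 0`) with the characteristic hypothesis removed.  This is
the solvable case of Dickson's classification of the finite subgroups of `PGL₂(k̄)` (Dickson
1901, §260; Huppert 1967, II.8.27), proved directly
(`projectiveType_of_not_hasCommonEigenvector_anyChar`).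
[cite: Huppert1967, Kap. II, §8, Hauptsatz 8.27] -/
theorem isDihedralType_or_isTetrahedralType_or_isOctahedralType_anyChar (ρ : G →* GL (Fin 2) k)
    [Finite ρ.range] (hirr : (toStdRepresentation ρ).IsIrreducible) (hs : IsSolvable ρ.range) :
    IsDihedralType ρ ∨ IsTetrahedralType ρ ∨ IsOctahedralType ρ := by
  set ι : ρ.range →* GL (Fin 2) k := ρ.range.subtype with hι
  have hPI : projectiveImage ι = projectiveImage ρ := projectiveImage_range_subtype ρ
  have hce : ¬ HasCommonEigenvector ι := by
    rintro ⟨v, hv0, key⟩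
    exact not_hasCommonEigenvector_of_isIrreducible ρ hirr
      ⟨v, hv0, fun g => key ⟨ρ g, g, rfl⟩⟩
  have hsol : IsSolvable (projectiveImage ι) := by
    rw [hPI]
    haveI := hs
    exact isSolvable_projectiveImage_of_range ρ
  rcases projectiveType_of_not_hasCommonEigenvector_anyChar ι hce hsol with h | h | h
  · obtain ⟨m, hm, ⟨e⟩⟩ := h
    exact Or.inl ⟨m, hm, ⟨(MulEquiv.subgroupCongr hPI.symm).trans e⟩⟩
  · obtain ⟨e⟩ := h
    exact Or.inr (Or.inl ⟨(MulEquiv.subgroupCongr hPI.symm).trans e⟩)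
  · obtain ⟨e⟩ := h
    exact Or.inr (Or.inr ⟨(MulEquiv.subgroupCongr hPI.symm).trans e⟩)

open Matrix.ProjGenLinGroup in
/-- **An element of projective order `> 4` forces dihedral type** (any characteristic): if
`ρ : G →* GL₂(k)` has finite solvable image, irreducible standard representation, and some
`\bar ρ(g)` has order `> 4` in `PGL₂(k)`, then `ρ` is of dihedral type — the elements of `𝔄₄`
and `𝔖₄` have order `≤ 4`.  This is how Dickson's theorem is used by Khare–Wintenberger, proof
of Lemma 6.3 (i) ("as `t > 5`, by Dickson's theorem the projective image of `ρ̄` is dihedral";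
there `\bar ρ(I_q)` contains an element of order a power of a prime `t > 5`).
[cite: KhareWintenberger2009, §6, proof of Lemma 6.3 (i)] -/
theorem isDihedralType_of_lt_orderOf_anyChar (ρ : G →* GL (Fin 2) k) [Finite ρ.range]
    (hirr : (toStdRepresentation ρ).IsIrreducible) (hs : IsSolvable ρ.range)
    {g : G} (hg : 4 < orderOf (mk (ρ g))) : IsDihedralType ρ := by
  set x : projectiveImage ρ := ⟨mk (ρ g), g, rfl⟩ with hx
  have hxord : orderOf x = orderOf (mk (ρ g)) := Subgroup.orderOf_mk _ _
  rcases isDihedralType_or_isTetrahedralType_or_isOctahedralType_anyChar ρ hirr hs with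
    h | h | h
  · exact h
  · exfalso
    obtain ⟨e⟩ := h
    have h1 : orderOf (e x) = orderOf x := MulEquiv.orderOf_eq e x
    have h2 : orderOf ((e x : alternatingGroup (Fin 4)) : Equiv.Perm (Fin 4)) = orderOf (e x) :=
      Subgroup.orderOf_coe _
    have h3 := PGL2AnyChar.orderOf_perm_fin_four_le ((e x : alternatingGroup (Fin 4)) :
      Equiv.Perm (Fin 4))
    rw [h2, h1, hxord] at h3
    omega
  · exfalso
    obtain ⟨e⟩ := h
    have h1 : orderOf (e x) = orderOf x := MulEquiv.orderOf_eq e x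
    have h3 := PGL2AnyChar.orderOf_perm_fin_four_le (e x)
    rw [h1, hxord] at h3
    omega

open Matrix.ProjGenLinGroup in
/-- **Khare–Wintenberger's use of Dickson's theorem, for a subgroup.**  Let `k` be algebraically
closed (any characteristic) and `H ≤ GL₂(k)` a finite solvable subgroup acting irreducibly on
`k²`.  If the image of `H` in `PGL₂(k)` contains an element of order `> 4` (e.g. of order a
power of a prime `t > 5`), then that image is dihedral (`IsDihedralType H.subtype`:
`≃* DihedralGroup m`, `m ≥ 2`). [cite: KhareWintenberger2009, §6, proof of Lemma 6.3 (i)] -/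
theorem isDihedralType_subtype_of_lt_orderOf (H : Subgroup (GL (Fin 2) k)) [Finite H]
    [IsSolvable H] (hirr : (toStdRepresentation H.subtype).IsIrreducible)
    {h : GL (Fin 2) k} (hh : h ∈ H) (h4 : 4 < orderOf (mk h)) : IsDihedralType H.subtype := by
  haveI : Finite H.subtype.range := finite_range_of_finite _
  have hs : IsSolvable H.subtype.range := by
    rw [H.range_subtype]
    infer_instance
  exact isDihedralType_of_lt_orderOf_anyChar H.subtype hirr hs (g := ⟨h, hh⟩) h4

end Main

end Literature.NumberTheory.GaloisRepresentations
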